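import Literature.IUT.HodgeArakelov.CohomologyAutConjCompat
import Literature.IUT.HodgeArakelov.CohomologyAutFunctorialityLaws
import Literature.IUT.HodgeArakelov.CohomologyAutCoeffChange
import Literature.IUT.HodgeArakelov.ConstantMultipleRigidity
import Literature.IUT.HodgeArakelov.EtaleThetaDataOfSetting

/-!
# [IUTchII] Cor 1.12 (i): the "action up to torsion" of an OUTER automorphism is well defined — the
# `ι`-invariants `(−)^ι` do not depend on the representative of `ι ∈ Aut(Π_Ÿ(Π))/Inn(Δ_Ÿ(Π))` on `θ(Π)`, `∞θ(Π)`

Proof-only companion (abc-iut cell, block C / wave W6, seat abc-iut-w6-d002; DAG node **IUTchII:Cor1.12(i)**,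
kernel id `N_IUTchII_Cor1_12_i`; sub-DAG `plan/L6/SUBDAG-IUTchII-Cor-112.md` row Cor-112.i.r12; NO definition, NO
`Prop`-valued fact) to abc-iut-L6-t1's `ConstantMultipleRigidity.lean` (p410537: the Cor. 1.12 (i) NOTATION
`iotaInvariants` / `iotaQuotOf`, `mem_iotaInvariants_iff`), `CohomologyAutFunctoriality.lean` / `CohomologyAutEquiv.lean`
(p413197 / p412842: the action `h1LimAut` / `h1LimAutEquiv` of an automorphism PAIR `(α, β)` on `lim_K H¹(H|_K, A)`),
abc-iut-w5-d169's `CohomologyAutFunctorialityLaws.lean` (composition law), abc-iut-w4-d014's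
`CohomologyAutCoeffChange.lean` (`autMap_eq_conj_of_inner`, the `H¹`-level inner case) and abc-iut-w4-d043's
`CohomologyLimitConj.lean` (p412726: the conjugation action `h1LimConj`). S. Mochizuki, *Inter-universal Teichmüller
theory II*, kurims manuscript (Dec. 2020), Cor. 1.12 (i) pp. 56–57 [cite: Mochizuki2012, Cor 1.12 (i) p.57]: "`ι` is a
`Δ_Ÿ(Π)`-outer automorphism of `Π_Ÿ(Π)` … If `(ι, D)` is a pointed inversion automorphism, and `ι` induces an 'action
up to torsion' on some subset '`(−)`' of an abelian group [i.e., an action on the image of this subset in the quotient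
of the abelian group by its torsion subgroup], then we shall denote by a superscript '`ι`' on '`(−)`' the subset of
`ι`-invariants with respect to this 'action up to torsion'"; Rmk. 1.4.1 (ii) p. 28 ("`ι_Ÿ ∈ Aut(Π^tp_Ÿ)/Inn(Δ^tp_Ÿ)`");
Prop. 1.4 p. 27 (`θ(Π)`, `∞θ(Π)` = "elements … for which some [positive integer] multiple coincides, up to torsion,
with an element of `θ(Π)`"). Claim key `Mochizuki2012` (D-0012, DISPUTED); the mathematics below is transport of
structure in group cohomology ([NSW] I §5) over the cell's own model objects; nothing of [IUTchII] is asserted; no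
side is taken on [IUTchIII] Cor. 3.12.

WHY. In the tree `ι` acts on the ∞-cohomology through a REPRESENTATIVE pair `(α, β)` (`h1LimAutEquiv`; at the model
`EtaleThetaDataOfSetting.pairRhoLim`; `PointedInversion.iota`/`iotaYdd` are representatives, `iotaYdd_lifts :
ι_Ÿ y = δ·ι(y)·δ⁻¹`). Print's `ι` is an OUTER class, and inner automorphisms by elements of `Π_Ÿ(Π)` do NOT act
trivially on the whole limit (at level `J` the action factors through `Π_Ÿ/(Π_Ÿ ∩ J)`, abc-iut-w4-d043's
`h1LimConj_of_normal_eq_of_mem`); what makes `(−)^ι` well defined on the sets print applies it to is that they act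
trivially UP TO TORSION there. PROVED: §1 (pure algebra) two automorphisms agreeing up to torsion on `X` induce THE
SAME action on the image of `X` modulo torsion and have the same `ι`-invariants in `X`
(`iotaQuotOf_mk_eq_of_isOfFinAddOrder_sub`, `iotaInvariants_eq_of_isOfFinAddOrder_sub`); §2 **an INNER pair acts on
the limit by conjugation**, `h1LimAut (conj c, conj φ(c)) = h1LimConj c` (`h1LimAut_eq_h1LimConj_of_inner`), so two
representatives of one `H`-outer class differ by `h1LimConj c` (`h1LimAut_eq_h1LimAut_h1LimConj_of_inner`); §3
**elements of `H = Π_Ÿ(Π)` act trivially up to torsion on every ∞-type class** — a class some positive multiple of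
which coincides up to torsion with a top-level class, the defining shape of `∞θ(Π)` (`θ(Π)` read in the limit: `n = 1`)
— (`isOfFinAddOrder_h1LimConj_sub_self`), hence two representatives agree up to torsion there, induce the same action
modulo torsion (`iotaQuotOf_h1LimAutEquiv_mk_eq_of_inner`) and have **the same `ι`-invariants up to torsion**
(`iotaInvariants_h1LimAutEquiv_eq_of_inner`; the `M + X` form for `M^×_TM·∞θ` takes the triviality on the Kummer
classes of the constants — Galois-equivariance of the Kummer map, [AbsTopIII] Prop. 3.2 — as an INPUT); §4 AT THE MODEL
`Π := Π^tp_{X̲̲}` (abc-iut-L6-t1's `etaleThetaDataOfSetting'`, REAL continuous cohomology): for two pairs differing by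
`Inn(c)`, `c ∈ Π^tp_{Ÿ̲̲}`, the sets `∞θ(Π)^ι` and `(θ(Π) in the limit)^ι` COINCIDE (`thetaInfty_iotaInvariants_eq_of_inner`,
`toLim_theta_iotaInvariants_eq_of_inner`). Honest residual inside this file: none (unconditional kernel theorems).
-/

namespace Literature.IUT.HodgeArakelov

open Literature.AnabelianGeometry.EtaleTheta CohomologySystemOfContH1

universe u

noncomputable section

/-! ## §1. Pure algebra: automorphisms agreeing up to torsion on `X` have the same `ι`-invariants in `X` -/

section Algebra

variable {L : Type u} [AddCommGroup L]

/-- The action INDUCED on `L / torsion` by an automorphism `e`, on classes: `ῑ [x] = [e x]` (unfolding of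
abc-iut-L6-t1's `iotaQuotOf`). [cite: Mochizuki2012, Cor 1.12 (i) p.57] -/
theorem iotaQuotOf_mk (e : L ≃+ L) (x : L) :
    iotaQuotOf e (QuotientAddGroup.mk x) = QuotientAddGroup.mk (e x) := rfl

/-- **Two automorphisms that agree up to torsion at `x` induce the same action on the image of `x` in
`L / torsion`** ("an action on the image of this subset in the quotient of the abelian group by its torsion
subgroup" is insensitive to torsion discrepancies). [cite: Mochizuki2012, Cor 1.12 (i) p.57] -/
theorem iotaQuotOf_mk_eq_of_isOfFinAddOrder_sub (e e' : L ≃+ L) (x : L)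
    (h : IsOfFinAddOrder (e' x - e x)) :
    iotaQuotOf e' (QuotientAddGroup.mk x) = iotaQuotOf e (QuotientAddGroup.mk x) := by
  rw [iotaQuotOf_mk, iotaQuotOf_mk, QuotientAddGroup.eq_iff_sub_mem]
  exact h

/-- **Two automorphisms that agree up to torsion on `X` have the same `ι`-invariants up to torsion in `X`**:
`X^{e'} = X^{e}`. [cite: Mochizuki2012, Cor 1.12 (i) p.57] -/
theorem iotaInvariants_eq_of_isOfFinAddOrder_sub (e e' : L ≃+ L) (X : Set L)
    (h : ∀ x ∈ X, IsOfFinAddOrder (e' x - e x)) :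
    iotaInvariants (iotaQuotOf e' : _ →+ _) X = iotaInvariants (iotaQuotOf e : _ →+ _) X := by
  ext x
  simp only [mem_iotaInvariants_iff]
  constructor
  · rintro ⟨hx, h'⟩
    have heq : e x - x = (e' x - x) + -(e' x - e x) := by abel
    exact ⟨hx, heq ▸ h'.add (h x hx).neg⟩
  · rintro ⟨hx, h'⟩
    have heq : e' x - x = (e' x - e x) + (e x - x) := by abel
    exact ⟨hx, heq ▸ (h x hx).add h'⟩

/-- The set of elements FIXED UP TO TORSION by an additive map is closed under addition; hence a sum set
`M + X` (`Set.image2 (· + ·)`, the shape of `M^×_TM·∞θ(Π)` of Cor. 1.12 (e)) is fixed up to torsion as soon as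
both summands are. [cite: Mochizuki2012, Cor 1.12 (i) p.57] -/
theorem isOfFinAddOrder_sub_self_of_mem_image2_add (s : L →+ L) {M X : Set L}
    (hM : ∀ m ∈ M, IsOfFinAddOrder (s m - m)) (hX : ∀ x ∈ X, IsOfFinAddOrder (s x - x))
    {y : L} (hy : y ∈ Set.image2 (· + ·) M X) : IsOfFinAddOrder (s y - y) := by
  obtain ⟨m, hm, x, hx, rfl⟩ := hy
  have heq : s (m + x) - (m + x) = (s m - m) + (s x - x) := by rw [map_add]; abel
  rw [heq]
  exact (hM m hm).add (hX x hx)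

end Algebra

/-! ## §2. On `lim_K H¹(H|_K, A)`: an INNER automorphism pair acts by conjugation -/

section Limit

variable {P : TopGroup.{u}} {G' : Type u} [Group G'] [TopologicalSpace G'] [IsTopologicalGroup G']
  (φ : P →* G') (A : Subgroup G') [A.Normal] [IsMulCommutative A] (H : Subgroup P)

/-- `h1LimAut` depends on the pair `(α, β)` only, not on the chosen proofs (rewriting helper for equal pairs;
the `AddEquiv` form is abc-iut-w5-d169's `h1LimAutEquiv_congr`). [cite: Mochizuki2012, Cor 1.12 (i) p.57] -/
theorem h1LimAut_congr {α α' : P ≃ₜ* P} {β β' : G' ≃ₜ* G'} (hα : α = α') (hβ : β = β')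
    (h : ∀ g, β (φ g) = φ (α g)) (hA : ∀ a : G', a ∈ A → β a ∈ A) (hH : ∀ x, x ∈ H ↔ α x ∈ H)
    (h' : ∀ g, β' (φ g) = φ (α' g)) (hA' : ∀ a : G', a ∈ A → β' a ∈ A) (hH' : ∀ x, x ∈ H ↔ α' x ∈ H)
    (z : h1Lim φ A H ⊥) :
    h1LimAut φ A H α β h hA hH z = h1LimAut φ A H α' β' h' hA' hH' z := by
  subst hα hβ
  rfl

variable [H.Normal]

/-- **An INNER pair acts on `lim_K H¹(H|_K, A)` by conjugation**: if `α` is conjugation by `c ∈ Π` and `β` is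
conjugation by `φ(c)` on the coefficients, then abc-iut-L6-t1's pair action `h1LimAut (α, β)` IS abc-iut-w4-d043's
conjugation action `h1LimConj c` (limit form of `ContH1Aut.autMap_eq_conj_of_inner`; the two indices `α(K) = cKc⁻¹`
and `core K` are compared at the normal level `core K ⊆ cKc⁻¹`). [cite: NeukirchSchmidtWingberg2008, I §5] -/
theorem h1LimAut_eq_h1LimConj_of_inner (α : P ≃ₜ* P) (β : G' ≃ₜ* G') (hφ : ∀ g, β (φ g) = φ (α g))
    (hA : ∀ a : G', a ∈ A → β a ∈ A) (hH : ∀ x, x ∈ H ↔ α x ∈ H) (c : P)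
    (hαc : ∀ g, α g = c * g * c⁻¹) (hβc : ∀ a : G', a ∈ A → β a = φ c * a * (φ c)⁻¹)
    (z : h1Lim φ A H ⊥) :
    h1LimAut φ A H α β hφ hA hH z = h1LimConj φ A H c z := by
  have hαs : ∀ x, α.symm x = c⁻¹ * x * c := fun x => by
    apply α.injective
    rw [ContinuousMulEquiv.apply_symm_apply, hαc]
    group
  have key : h1LimAut φ A H α β hφ hA hH = h1LimConj φ A H c := by
    refine h1Lim_hom_ext φ A H fun i y => ?_
    rw [h1LimAut_of, h1LimConj_of, conjAt_apply]
    -- indices: `core K ≤ c K c⁻¹ = α(K)`, i.e. `mapAut α i ≤ i.core` in the reverse-inclusion order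
    have hle : Idx.mapAut α i ≤ i.core := by
      refine Idx.le_iff.mpr fun x hx => ?_
      rw [Idx.K_mapAut]
      refine Subgroup.mem_map.mpr ⟨c⁻¹ * x * c, ?_, ?_⟩
      · exact (i.K).normalCore_le (Subgroup.Normal.conj_mem' inferInstance x hx c)
      · change α (c⁻¹ * x * c) = x
        rw [hαc]
        group
    -- `α⁻¹` stabilises the normal level `H ⊓ core K`
    have hcore : ∀ x, x ∈ H ⊓ i.core.K → α.symm x ∈ H ⊓ i.core.K := fun x hx => by
      rw [hαs]
      exact Subgroup.Normal.conj_mem' inferInstance x hx c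
    rw [← h1Of_fmod φ A H ⊥ hle]
    congr 1
    -- restricting the transport to `H ⊓ core K` = transporting the restriction (naturality `res_autMap`)
    have h1 : fmod φ A H ⊥ (Idx.mapAut α i) i.core hle
        (Additive.ofMul (ContH1Aut.autMap φ A α β hφ hA (symm_mem_inf H α hH i.K) (Additive.toMul y))) =
        Additive.ofMul (ContH1Aut.autMap φ A α β hφ hA hcore
          (Additive.toMul (fmod φ A H ⊥ i i.core i.le_core y))) :=
      congrArg Additive.ofMul (ContH1Aut.res_autMap φ A α β hφ hA
        (inf_le_inf_left H (Idx.le_iff.mp i.le_core)) (inf_le_inf_left H (Idx.le_iff.mp hle))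
        hcore (symm_mem_inf H α hH i.K) (Additive.toMul y))
    rw [h1]
    -- at the normal level the inner pair acts by `ContH1.conj c`
    exact congrArg Additive.ofMul
      (ContH1Aut.autMap_eq_conj_of_inner φ α β hφ hA hcore c hαc hβc
        (Additive.toMul (fmod φ A H ⊥ i i.core i.le_core y)))
  exact DFunLike.congr_fun key z

/-- **Two representatives of the same outer class differ by the conjugation action**: if the compatible pairs
`(α₁, β₁)`, `(α₂, β₂)` differ by the inner pair of `c` — `α₂ = α₁ ∘ Inn(c)`, `β₂ = β₁ ∘ Inn(φ c)` on `A` — then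
`ρ_(α₂,β₂) = ρ_(α₁,β₁) ∘ conj_c` on `lim_K H¹(H|_K, A)` (composition law of abc-iut-w5-d169 + the inner case).
[cite: NeukirchSchmidtWingberg2008, I §5] -/
theorem h1LimAut_eq_h1LimAut_h1LimConj_of_inner {α₁ α₂ : P ≃ₜ* P} {β₁ β₂ : G' ≃ₜ* G'}
    (h₁ : ∀ g, β₁ (φ g) = φ (α₁ g)) (h₂ : ∀ g, β₂ (φ g) = φ (α₂ g))
    (hA₁ : ∀ a : G', a ∈ A ↔ β₁ a ∈ A) (hA₂ : ∀ a : G', a ∈ A → β₂ a ∈ A)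
    (hH₁ : ∀ x, x ∈ H ↔ α₁ x ∈ H) (hH₂ : ∀ x, x ∈ H ↔ α₂ x ∈ H) (c : P)
    (hα : ∀ g, α₂ g = α₁ (c * g * c⁻¹)) (hβ : ∀ a : G', a ∈ A → β₂ a = β₁ (φ c * a * (φ c)⁻¹))
    (z : h1Lim φ A H ⊥) :
    h1LimAut φ A H α₂ β₂ h₂ hA₂ hH₂ z =
      h1LimAut φ A H α₁ β₁ h₁ (fun a ha => (hA₁ a).mp ha) hH₁ (h1LimConj φ A H c z) := by
  -- the quotient pair `(γ, δ) := (α₂ ∘ α₁⁻¹, β₂ ∘ β₁⁻¹)` is inner by `c`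
  have hγ : ∀ g, (β₂.trans β₁.symm) (φ g) = φ ((α₂.trans α₁.symm) g) :=
    ContH1Aut.compat_trans φ h₂ (ContH1Aut.compat_symm φ α₁ β₁ h₁)
  have hAγ : ∀ a : G', a ∈ A → (β₂.trans β₁.symm) a ∈ A :=
    ContH1Aut.mem_trans A hA₂ (ContH1Aut.mem_symm A β₁ hA₁)
  have hHγ : ∀ x, x ∈ H ↔ (α₂.trans α₁.symm) x ∈ H := stab_trans H hH₂ (stab_symm H α₁ hH₁)
  have hγc : ∀ g, (α₂.trans α₁.symm) g = c * g * c⁻¹ := fun g => by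
    rw [ContinuousMulEquiv.trans_apply, hα, ContinuousMulEquiv.symm_apply_apply]
  have hδc : ∀ a : G', a ∈ A → (β₂.trans β₁.symm) a = φ c * a * (φ c)⁻¹ := fun a ha => by
    rw [ContinuousMulEquiv.trans_apply, hβ a ha, ContinuousMulEquiv.symm_apply_apply]
  have hinner := h1LimAut_eq_h1LimConj_of_inner φ A H (α₂.trans α₁.symm) (β₂.trans β₁.symm) hγ hAγ hHγ c
    hγc hδc z
  -- `(γ ≫ α₁, δ ≫ β₁) = (α₂, β₂)`
  have hαeq : (α₂.trans α₁.symm).trans α₁ = α₂ :=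
    ContinuousMulEquiv.ext fun g => by
      rw [ContinuousMulEquiv.trans_apply, ContinuousMulEquiv.trans_apply, ContinuousMulEquiv.apply_symm_apply]
  have hβeq : (β₂.trans β₁.symm).trans β₁ = β₂ :=
    ContinuousMulEquiv.ext fun g => by
      rw [ContinuousMulEquiv.trans_apply, ContinuousMulEquiv.trans_apply, ContinuousMulEquiv.apply_symm_apply]
  rw [← hinner, h1LimAut_trans φ A H hγ h₁ hAγ (fun a ha => (hA₁ a).mp ha) hHγ hH₁ z]
  exact h1LimAut_congr φ A H hαeq.symm hβeq.symm _ _ _ _ _ _ z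

/-! ## §3. Elements of `H` act trivially UP TO TORSION on ∞-type classes; `(−)^ι` is independent of the representative -/

/-- **Elements of `H = Π_Ÿ(Π)` act trivially UP TO TORSION on every ∞-type class**: if some positive multiple of
`x ∈ lim_K H¹(H|_K, A)` coincides up to torsion with a class of the top level `H1 ⊤ ≅ H¹(H, A)` (the defining shape
of `∞θ(Π)`, Prop. 1.4; `θ(Π)` itself is the case `n = 1`), then `conj_σ x − x` is torsion for every `σ ∈ H` — because
`σ` FIXES the top-level classes (abc-iut-w4-d043's `toLim_h1TopConjEquiv` + `h1TopConjEquiv_eq_self_of_mem`, L2's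
`conj_eq_self_of_mem`). [cite: NeukirchSchmidtWingberg2008, I §5] -/
theorem isOfFinAddOrder_h1LimConj_sub_self {σ : P} (hσ : σ ∈ H) {x : h1Lim φ A H ⊥}
    (hx : ∃ n : ℕ, 0 < n ∧ ∃ t : h1Lim φ A H ⊤,
      IsOfFinAddOrder (n • x - h1Res φ A H (bot_le : (⊥ : Subgroup P) ≤ ⊤) t)) :
    IsOfFinAddOrder (h1LimConj φ A H σ x - x) := by
  obtain ⟨n, hn, t, ht⟩ := hx
  -- `σ ∈ H` FIXES the top-level class `toLim ⊤ t` (`toLim ⊤ = h1Res bot_le` by definition)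
  have hfix : h1LimConj φ A H σ (h1Res φ A H (bot_le : (⊥ : Subgroup P) ≤ ⊤) t) =
      h1Res φ A H (bot_le : (⊥ : Subgroup P) ≤ ⊤) t := by
    have h := toLim_h1TopConjEquiv φ A H σ t
    rw [h1TopConjEquiv_eq_self_of_mem φ A H hσ, h1LimConjEquiv_apply] at h
    exact h.symm
  have heq : n • (h1LimConj φ A H σ x - x) =
      h1LimConj φ A H σ (n • x - h1Res φ A H (bot_le : (⊥ : Subgroup P) ≤ ⊤) t) -
        (n • x - h1Res φ A H (bot_le : (⊥ : Subgroup P) ≤ ⊤) t) := by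
    rw [map_sub, map_nsmul, hfix, nsmul_sub, sub_sub_sub_cancel_right]
  have hn' : IsOfFinAddOrder (n • (h1LimConj φ A H σ x - x)) := by
    rw [heq, sub_eq_add_neg]
    exact ((h1LimConj φ A H σ).isOfFinAddOrder ht).add ht.neg
  exact hn'.of_nsmul hn.ne'

/-- Hence **two representatives of the same `H`-outer class AGREE UP TO TORSION on every ∞-type class**:
`ρ_(α₂,β₂) x − ρ_(α₁,β₁) x` is torsion whenever `(α₂, β₂) = (α₁, β₁) ∘ Inn(c)` with `c ∈ H`.
[cite: Mochizuki2012, Cor 1.12 (i) p.57] -/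
theorem isOfFinAddOrder_h1LimAut_sub_h1LimAut_of_inner {α₁ α₂ : P ≃ₜ* P} {β₁ β₂ : G' ≃ₜ* G'}
    (h₁ : ∀ g, β₁ (φ g) = φ (α₁ g)) (h₂ : ∀ g, β₂ (φ g) = φ (α₂ g))
    (hA₁ : ∀ a : G', a ∈ A ↔ β₁ a ∈ A) (hA₂ : ∀ a : G', a ∈ A → β₂ a ∈ A)
    (hH₁ : ∀ x, x ∈ H ↔ α₁ x ∈ H) (hH₂ : ∀ x, x ∈ H ↔ α₂ x ∈ H) {c : P} (hc : c ∈ H)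
    (hα : ∀ g, α₂ g = α₁ (c * g * c⁻¹)) (hβ : ∀ a : G', a ∈ A → β₂ a = β₁ (φ c * a * (φ c)⁻¹))
    {x : h1Lim φ A H ⊥}
    (hx : ∃ n : ℕ, 0 < n ∧ ∃ t : h1Lim φ A H ⊤,
      IsOfFinAddOrder (n • x - h1Res φ A H (bot_le : (⊥ : Subgroup P) ≤ ⊤) t)) :
    IsOfFinAddOrder (h1LimAut φ A H α₂ β₂ h₂ hA₂ hH₂ x -
      h1LimAut φ A H α₁ β₁ h₁ (fun a ha => (hA₁ a).mp ha) hH₁ x) := by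
  rw [h1LimAut_eq_h1LimAut_h1LimConj_of_inner φ A H h₁ h₂ hA₁ hA₂ hH₁ hH₂ c hα hβ x, ← map_sub]
  exact (h1LimAut φ A H α₁ β₁ h₁ _ hH₁).isOfFinAddOrder (isOfFinAddOrder_h1LimConj_sub_self φ A H hc hx)

/-- **The "action up to torsion" induced by `ι` is independent of the representative**: on the image modulo
torsion of an ∞-type class, two representatives `(α₁, β₁)`, `(α₂, β₂) = (α₁, β₁) ∘ Inn(c)` (`c ∈ H`) of the same
outer class induce THE SAME element of `lim / torsion` (the printed "action on the image of this subset in the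
quotient of the abelian group by its torsion subgroup" of Cor. 1.12 (i), for abc-iut-L6-t1's `h1LimAutEquiv`).
[cite: Mochizuki2012, Cor 1.12 (i) p.57] -/
theorem iotaQuotOf_h1LimAutEquiv_mk_eq_of_inner {α₁ α₂ : P ≃ₜ* P} {β₁ β₂ : G' ≃ₜ* G'}
    (h₁ : ∀ g, β₁ (φ g) = φ (α₁ g)) (h₂ : ∀ g, β₂ (φ g) = φ (α₂ g))
    (hA₁ : ∀ a : G', a ∈ A ↔ β₁ a ∈ A) (hA₂ : ∀ a : G', a ∈ A ↔ β₂ a ∈ A)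
    (hH₁ : ∀ x, x ∈ H ↔ α₁ x ∈ H) (hH₂ : ∀ x, x ∈ H ↔ α₂ x ∈ H) {c : P} (hc : c ∈ H)
    (hα : ∀ g, α₂ g = α₁ (c * g * c⁻¹)) (hβ : ∀ a : G', a ∈ A → β₂ a = β₁ (φ c * a * (φ c)⁻¹))
    {x : h1Lim φ A H ⊥}
    (hx : ∃ n : ℕ, 0 < n ∧ ∃ t : h1Lim φ A H ⊤,
      IsOfFinAddOrder (n • x - h1Res φ A H (bot_le : (⊥ : Subgroup P) ≤ ⊤) t)) :
    iotaQuotOf (h1LimAutEquiv φ A H α₂ β₂ h₂ hA₂ hH₂) (QuotientAddGroup.mk x) =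
      iotaQuotOf (h1LimAutEquiv φ A H α₁ β₁ h₁ hA₁ hH₁) (QuotientAddGroup.mk x) := by
  refine iotaQuotOf_mk_eq_of_isOfFinAddOrder_sub _ _ x ?_
  rw [h1LimAutEquiv_apply, h1LimAutEquiv_apply]
  exact isOfFinAddOrder_h1LimAut_sub_h1LimAut_of_inner φ A H h₁ h₂ hA₁ (fun a ha => (hA₂ a).mp ha) hH₁ hH₂ hc
    hα hβ hx

/-- **`(−)^ι` is independent of the representative of the outer class** (general form): for two representatives
`(α₁, β₁)`, `(α₂, β₂) = (α₁, β₁) ∘ Inn(c)` and any subset `X ⊆ lim_K H¹(H|_K, A)` on which `conj_c` is trivial up to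
torsion, the `ι`-invariants up to torsion (abc-iut-L6-t1's `iotaInvariants` for the induced actions `iotaQuotOf`)
COINCIDE: `X^{(α₂,β₂)} = X^{(α₁,β₁)}`. [cite: Mochizuki2012, Cor 1.12 (i) p.57] -/
theorem iotaInvariants_h1LimAutEquiv_eq_of_inner_of_forall {α₁ α₂ : P ≃ₜ* P} {β₁ β₂ : G' ≃ₜ* G'}
    (h₁ : ∀ g, β₁ (φ g) = φ (α₁ g)) (h₂ : ∀ g, β₂ (φ g) = φ (α₂ g))
    (hA₁ : ∀ a : G', a ∈ A ↔ β₁ a ∈ A) (hA₂ : ∀ a : G', a ∈ A ↔ β₂ a ∈ A)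
    (hH₁ : ∀ x, x ∈ H ↔ α₁ x ∈ H) (hH₂ : ∀ x, x ∈ H ↔ α₂ x ∈ H) (c : P)
    (hα : ∀ g, α₂ g = α₁ (c * g * c⁻¹)) (hβ : ∀ a : G', a ∈ A → β₂ a = β₁ (φ c * a * (φ c)⁻¹))
    {X : Set (h1Lim φ A H ⊥)} (hX : ∀ x ∈ X, IsOfFinAddOrder (h1LimConj φ A H c x - x)) :
    iotaInvariants (iotaQuotOf (h1LimAutEquiv φ A H α₂ β₂ h₂ hA₂ hH₂) : _ →+ _) X =
      iotaInvariants (iotaQuotOf (h1LimAutEquiv φ A H α₁ β₁ h₁ hA₁ hH₁) : _ →+ _) X := by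
  refine iotaInvariants_eq_of_isOfFinAddOrder_sub _ _ X fun x hx => ?_
  rw [h1LimAutEquiv_apply, h1LimAutEquiv_apply,
    h1LimAut_eq_h1LimAut_h1LimConj_of_inner φ A H h₁ h₂ hA₁ (fun a ha => (hA₂ a).mp ha) hH₁ hH₂ c hα hβ x,
    ← map_sub]
  exact (h1LimAut φ A H α₁ β₁ h₁ _ hH₁).isOfFinAddOrder (hX x hx)

/-- **`(−)^ι` is independent of the representative of the `H`-outer class on every set of ∞-type classes**
(`∞θ(Π)`; `θ(Π)` read in the limit): `X^{(α₂,β₂)} = X^{(α₁,β₁)}` for `(α₂, β₂) = (α₁, β₁) ∘ Inn(c)`, `c ∈ H`.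
[cite: Mochizuki2012, Cor 1.12 (i) p.57] -/
theorem iotaInvariants_h1LimAutEquiv_eq_of_inner {α₁ α₂ : P ≃ₜ* P} {β₁ β₂ : G' ≃ₜ* G'}
    (h₁ : ∀ g, β₁ (φ g) = φ (α₁ g)) (h₂ : ∀ g, β₂ (φ g) = φ (α₂ g))
    (hA₁ : ∀ a : G', a ∈ A ↔ β₁ a ∈ A) (hA₂ : ∀ a : G', a ∈ A ↔ β₂ a ∈ A)
    (hH₁ : ∀ x, x ∈ H ↔ α₁ x ∈ H) (hH₂ : ∀ x, x ∈ H ↔ α₂ x ∈ H) {c : P} (hc : c ∈ H)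
    (hα : ∀ g, α₂ g = α₁ (c * g * c⁻¹)) (hβ : ∀ a : G', a ∈ A → β₂ a = β₁ (φ c * a * (φ c)⁻¹))
    {X : Set (h1Lim φ A H ⊥)}
    (hX : ∀ x ∈ X, ∃ n : ℕ, 0 < n ∧ ∃ t : h1Lim φ A H ⊤,
      IsOfFinAddOrder (n • x - h1Res φ A H (bot_le : (⊥ : Subgroup P) ≤ ⊤) t)) :
    iotaInvariants (iotaQuotOf (h1LimAutEquiv φ A H α₂ β₂ h₂ hA₂ hH₂) : _ →+ _) X =
      iotaInvariants (iotaQuotOf (h1LimAutEquiv φ A H α₁ β₁ h₁ hA₁ hH₁) : _ →+ _) X :=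
  iotaInvariants_h1LimAutEquiv_eq_of_inner_of_forall φ A H h₁ h₂ hA₁ hA₂ hH₁ hH₂ c hα hβ fun x hx =>
    isOfFinAddOrder_h1LimConj_sub_self φ A H hc (hX x hx)

/-- The `M + X` form (the shape `M^×_TM·∞θ(Π)` of Cor. 1.12 (e)): if `conj_c` is trivial up to torsion on `M` (for
the Kummer classes of the constants: the Galois-equivariance of the Kummer map, [AbsTopIII] Prop. 3.2 — an INPUT
here) and `X` consists of ∞-type classes, then `(M + X)^{(α₂,β₂)} = (M + X)^{(α₁,β₁)}` for two representatives
differing by `Inn(c)`, `c ∈ H`. [cite: Mochizuki2012, Cor 1.12 (i) p.57] -/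
theorem iotaInvariants_image2_add_h1LimAutEquiv_eq_of_inner {α₁ α₂ : P ≃ₜ* P} {β₁ β₂ : G' ≃ₜ* G'}
    (h₁ : ∀ g, β₁ (φ g) = φ (α₁ g)) (h₂ : ∀ g, β₂ (φ g) = φ (α₂ g))
    (hA₁ : ∀ a : G', a ∈ A ↔ β₁ a ∈ A) (hA₂ : ∀ a : G', a ∈ A ↔ β₂ a ∈ A)
    (hH₁ : ∀ x, x ∈ H ↔ α₁ x ∈ H) (hH₂ : ∀ x, x ∈ H ↔ α₂ x ∈ H) {c : P} (hc : c ∈ H)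
    (hα : ∀ g, α₂ g = α₁ (c * g * c⁻¹)) (hβ : ∀ a : G', a ∈ A → β₂ a = β₁ (φ c * a * (φ c)⁻¹))
    {M X : Set (h1Lim φ A H ⊥)} (hM : ∀ m ∈ M, IsOfFinAddOrder (h1LimConj φ A H c m - m))
    (hX : ∀ x ∈ X, ∃ n : ℕ, 0 < n ∧ ∃ t : h1Lim φ A H ⊤,
      IsOfFinAddOrder (n • x - h1Res φ A H (bot_le : (⊥ : Subgroup P) ≤ ⊤) t)) :
    iotaInvariants (iotaQuotOf (h1LimAutEquiv φ A H α₂ β₂ h₂ hA₂ hH₂) : _ →+ _) (Set.image2 (· + ·) M X) =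
      iotaInvariants (iotaQuotOf (h1LimAutEquiv φ A H α₁ β₁ h₁ hA₁ hH₁) : _ →+ _)
        (Set.image2 (· + ·) M X) :=
  iotaInvariants_h1LimAutEquiv_eq_of_inner_of_forall φ A H h₁ h₂ hA₁ hA₂ hH₁ hH₂ c hα hβ fun _ hy =>
    isOfFinAddOrder_sub_self_of_mem_image2_add (h1LimConj φ A H c) hM
      (fun x hx => isOfFinAddOrder_h1LimConj_sub_self φ A H hc (hX x hx)) hy

end Limit

/-! ## §4. At the model `Π := Π^tp_{X̲̲}`: `∞θ(Π)^ι` and `θ(Π)^ι` do not depend on the representative of `ι` -/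

namespace EtaleThetaDataOfSetting

variable {p : ℕ} [Fact p.Prime] {D : Literature.AnabelianGeometry.EtaleTheta.ThetaSetting p}
  {E : D.EtaleThetaData} {l : ℕ} (C : E.DoubleUnderline l) [(PiYdd C).Normal] (hC : D.Compat)
  (hS : D.Sec2Hyps) (hchar : PiYddCharacteristic C) (S : ThetaSetting.{0}) (eS : (Pi C) ≃ₜ* S.PiX) (hl : S.l = l)

/-- AT THE MODEL (abc-iut-L6-t1's `etaleThetaDataOfSetting'`, REAL continuous cohomology of `Π^tp_{Ÿ̲̲} ⊴ Π^tp_{X̲̲}`):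
every element of **`∞θ(Π)`** is an ∞-type class of `lim_J H¹(Π^tp_{Ÿ̲̲} ∩ J, l·Δ_Θ)` (by its very definition,
Prop. 1.4), so elements of `Π^tp_{Ÿ̲̲}` act trivially on it up to torsion. [cite: Mochizuki2012, Prop 1.4 p.27] -/
theorem isOfFinAddOrder_h1LimConj_sub_self_of_mem_thetaInfty {σ : Pi C} (hσ : σ ∈ PiYdd C)
    {x : h1Lim (phi C) (D.lDeltaTheta l) (PiYdd C) ⊥}
    (hx : x ∈ ((etaleThetaDataOfSetting' C hC hS hchar S eS hl).thetaInfty :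
      Set (h1Lim (phi C) (D.lDeltaTheta l) (PiYdd C) ⊥))) :
    IsOfFinAddOrder (h1LimConj (phi C) (D.lDeltaTheta l) (PiYdd C) σ x - x) := by
  obtain ⟨n, hn, t, _, ht⟩ := hx
  exact isOfFinAddOrder_h1LimConj_sub_self (phi C) (D.lDeltaTheta l) (PiYdd C) hσ ⟨n, hn, t, ht⟩

/-- **[IUTchII] Cor. 1.12 (i) at the model: `∞θ(Π)^ι` does not depend on the representative of the outer class
`ι`.** For two automorphism pairs `(α₁, β₁)`, `(α₂, β₂)` of `(Π^tp_{X̲̲}, (Π^tp_X)^Θ)` (compatible with `φ`, carrying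
`l·Δ_Θ` onto itself, stabilising `Π^tp_{Ÿ̲̲}` — the shape of abc-iut-w5-d072's `pairRhoLim` / of
`PointedInversion.iota`) that differ by the inner pair of an element `c ∈ Π^tp_{Ÿ̲̲}`, the `ι`-invariants up to
torsion of `∞θ(Π)` for the two induced actions `h1LimAutEquiv` COINCIDE. [cite: Mochizuki2012, Cor 1.12 (i) p.57] -/
theorem thetaInfty_iotaInvariants_eq_of_inner {α₁ α₂ : (Pi C) ≃ₜ* (Pi C)} {β₁ β₂ : D.GtpTheta ≃ₜ* D.GtpTheta}
    (h₁ : ∀ g, β₁ (phi C g) = phi C (α₁ g)) (h₂ : ∀ g, β₂ (phi C g) = phi C (α₂ g))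
    (hA₁ : ∀ a : D.GtpTheta, a ∈ D.lDeltaTheta l ↔ β₁ a ∈ D.lDeltaTheta l)
    (hA₂ : ∀ a : D.GtpTheta, a ∈ D.lDeltaTheta l ↔ β₂ a ∈ D.lDeltaTheta l)
    (hH₁ : ∀ x, x ∈ PiYdd C ↔ α₁ x ∈ PiYdd C) (hH₂ : ∀ x, x ∈ PiYdd C ↔ α₂ x ∈ PiYdd C)
    {c : Pi C} (hc : c ∈ PiYdd C) (hα : ∀ g, α₂ g = α₁ (c * g * c⁻¹))
    (hβ : ∀ a : D.GtpTheta, a ∈ D.lDeltaTheta l → β₂ a = β₁ (phi C c * a * (phi C c)⁻¹)) :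
    iotaInvariants (L := h1Lim (phi C) (D.lDeltaTheta l) (PiYdd C) ⊥)
        (iotaQuotOf (h1LimAutEquiv (phi C) (D.lDeltaTheta l) (PiYdd C) α₂ β₂ h₂ hA₂ hH₂) : _ →+ _)
        (etaleThetaDataOfSetting' C hC hS hchar S eS hl).thetaInfty =
      iotaInvariants (L := h1Lim (phi C) (D.lDeltaTheta l) (PiYdd C) ⊥)
        (iotaQuotOf (h1LimAutEquiv (phi C) (D.lDeltaTheta l) (PiYdd C) α₁ β₁ h₁ hA₁ hH₁) : _ →+ _)
        (etaleThetaDataOfSetting' C hC hS hchar S eS hl).thetaInfty := by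
  exact iotaInvariants_h1LimAutEquiv_eq_of_inner (phi C) (D.lDeltaTheta l) (PiYdd C) h₁ h₂ hA₁ hA₂ hH₁ hH₂ hc
    hα hβ fun x hx => by
      obtain ⟨n, hn, t, _, ht⟩ := hx
      exact ⟨n, hn, t, ht⟩

/-- **[IUTchII] Cor. 1.12 (i) at the model: `θ(Π)^ι` (read in the limit) does not depend on the representative of
the outer class `ι`** — same statement for the image `toLim ⊤ '' θ(Π)` of the top-level set `θ(Π)` (∞-type with
`n = 1`). [cite: Mochizuki2012, Cor 1.12 (i) p.57] -/
theorem toLim_theta_iotaInvariants_eq_of_inner {α₁ α₂ : (Pi C) ≃ₜ* (Pi C)} {β₁ β₂ : D.GtpTheta ≃ₜ* D.GtpTheta}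
    (h₁ : ∀ g, β₁ (phi C g) = phi C (α₁ g)) (h₂ : ∀ g, β₂ (phi C g) = phi C (α₂ g))
    (hA₁ : ∀ a : D.GtpTheta, a ∈ D.lDeltaTheta l ↔ β₁ a ∈ D.lDeltaTheta l)
    (hA₂ : ∀ a : D.GtpTheta, a ∈ D.lDeltaTheta l ↔ β₂ a ∈ D.lDeltaTheta l)
    (hH₁ : ∀ x, x ∈ PiYdd C ↔ α₁ x ∈ PiYdd C) (hH₂ : ∀ x, x ∈ PiYdd C ↔ α₂ x ∈ PiYdd C)
    {c : Pi C} (hc : c ∈ PiYdd C) (hα : ∀ g, α₂ g = α₁ (c * g * c⁻¹))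
    (hβ : ∀ a : D.GtpTheta, a ∈ D.lDeltaTheta l → β₂ a = β₁ (phi C c * a * (phi C c)⁻¹)) :
    iotaInvariants (L := h1Lim (phi C) (D.lDeltaTheta l) (PiYdd C) ⊥)
        (iotaQuotOf (h1LimAutEquiv (phi C) (D.lDeltaTheta l) (PiYdd C) α₂ β₂ h₂ hA₂ hH₂) : _ →+ _)
        ((coh C).toLim ⊤ '' (etaleThetaDataOfSetting' C hC hS hchar S eS hl).theta) =
      iotaInvariants (L := h1Lim (phi C) (D.lDeltaTheta l) (PiYdd C) ⊥)
        (iotaQuotOf (h1LimAutEquiv (phi C) (D.lDeltaTheta l) (PiYdd C) α₁ β₁ h₁ hA₁ hH₁) : _ →+ _)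
        ((coh C).toLim ⊤ '' (etaleThetaDataOfSetting' C hC hS hchar S eS hl).theta) := by
  exact iotaInvariants_h1LimAutEquiv_eq_of_inner (phi C) (D.lDeltaTheta l) (PiYdd C) h₁ h₂ hA₁ hA₂ hH₁ hH₂ hc
    hα hβ fun x hx => by
      obtain ⟨t, _, rfl⟩ := hx
      refine ⟨1, Nat.one_pos, t, ?_⟩
      -- `toLim ⊤ = h1Res bot_le` by definition
      change IsOfFinAddOrder ((1 : ℕ) • h1Res (phi C) (D.lDeltaTheta l) (PiYdd C)
          (bot_le : (⊥ : Subgroup (Pi C)) ≤ ⊤) t -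
        h1Res (phi C) (D.lDeltaTheta l) (PiYdd C) (bot_le : (⊥ : Subgroup (Pi C)) ≤ ⊤) t)
      rw [one_nsmul, sub_self]
      exact IsOfFinAddOrder.zero

end EtaleThetaDataOfSetting

end

end Literature.IUT.HodgeArakelov
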